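/-
Copyright (c) 2026 the pub-hodgecm-mathlib formalisation cell (harness21).  Prover seat hodgecm-mathlib-K2E4-p14 (g9), Track B ∕ K2-LIT, h413 = `stmt-HodgeConjecture-24833`,
line `K2_E1_TraceFormulaBeta`, campaign 5Res ∕ 12R3 (ROADCARD §3′ M2 v2), after (245) («propose the next unowned item»): the SOCKETS 5Res ∕ 12R3 BY NAME from the ATOMS package —
★ p860247's `∀ L μ ∃ K`-package shape with `hadm` replaced by the atoms of ★ `K2E1ResidualLevelFiniteOfAtomsU` (this seat, p860390).
-/
import Summits.HodgeConjecture.HodgeConjecture.Theorems.K2E1ResidualLevelFiniteOfAtomsU   -- ★ p860390 (this seat): `residualSpectrumCompact_of_atoms` (generic `𝒢`)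
import HarnessLib

/-!
# K2·E1 — `K2E1ResidualCompactOfAtomsSigs`: THE SOCKETS 5Res ∕ 12R3 BY NAME ⟸ the `∀ L μ ∃ K`-package of ATOMS (top of the D-road, `U(Φ_N)∕CM` print)

Track B ∕ K2-LIT, crux h413 = `stmt-HodgeConjecture-24833`, route of record `HCCMUnconditional`; cell `hodgecm-mathlib`, squad K2, ENGINE E1 (campaign 5Res ∕ 12R3, ROADCARD §3′ M2 v2).
THEOREMS ONLY (no `def`, no `instance`, no notation, no named-fact hypothesis, no `sorry`); lane `--supports stmt-HodgeConjecture-24833 --as helper` (count-neutral).  Closes no socket.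

WHAT.  ★ p860247 `K2E1ResidualCompactOfAdmissibleU2.sig_K2E1ResidualCompactU2_of_admissible` ∕ `…U3R_of_admissible` read the sockets 5Res :247 ∕ 12R3 :293 BY NAME from the
`∀ L μ ∃ K`-package «`L²_res` is `K`-admissible» (`hadm`).  THIS FILE replaces `hadm` by the ATOMS of ★ `K2E1ResidualLevelFiniteOfAtomsU` (this seat): for every CM field `L` and
automorphic `μ` THERE ARE a compact Hausdorff `K →* U(Φ_N)(𝔸_{L⁺})` (continuous), an abelian-central factor `ιa : T →* K`, a profinite factor `ιf : K_f →* K` with continuous orbit maps on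
`L²_res`, and for every `(χ : T →* ℂ, U ≤ K_f open)` a continuous linear `P` on `L²` fixing the `(χ,U)`-eigenvectors together with a finite-dimensional `A` containing `P(W)` for
every irreducible closed `W ≤ L²_res` — in print `K = K_∞ × K_f`, `P = R(e_χ ⊗ e_U)` ((S2c)), `A` from D5′ + (FIN) via ★ `hatoms_of_noLineMass` ∕ `hEXH_of_orthogonalBlocks`.  THEN
`CmResidualSpectrumCompact L 2 μ` (5Res) resp. `CmResidualSpectrumCompactR L 3 μ` (12R3): ★ `residualSpectrumCompact_of_atoms` (★ `U(Φ_N)(𝔸)` locally compact).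
* **`sig_K2E1ResidualCompactU2_of_atoms`**, **`sig_K2E1ResidualCompactU3R_of_atoms`**.
HONEST LABEL: HC_CM is proved only modulo the 7 printed citations (2 remaining named inputs: hLiu418 = `stmt-HodgeConjecture-24832`, h413 = `stmt-HodgeConjecture-24833`) until rung 0
closes; this file asserts no named fact and closes no socket — 5Res ∕ 12R3 stay OPEN until the atoms package is ★ (payers per the 14th-issue §F letter list).

## References
* [MoeglinWaldspurger1995] C. Mœglin, J.-L. Waldspurger, *Spectral decomposition and Eisenstein series* (1995), I.2.18, V.3.13.
* [HarishChandra1968] Harish-Chandra, *Automorphic forms on semisimple Lie groups*, LNM 62 (1968), Thm. 1.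
* [Rogawski1990] J. Rogawski, *Automorphic representations of unitary groups in three variables* (1990), §13.5, §13.9.
-/

set_option autoImplicit false
-- the mandated namespace repeats the single-problem summit's segment (`HodgeConjecture.HodgeConjecture`)
set_option linter.dupNamespace false

noncomputable section

open MeasureTheory Measure Topology NumberField IsDedekindDomain
open Literature.NumberTheory.Automorphic Literature.NumberTheory.Automorphic.UnitaryGroup AdelicGroupData
open Summit.HodgeConjecture.HodgeConjecture.Cruxes.H413.K2E1CuspidalSpectrumUnitary
open Summit.HodgeConjecture.HodgeConjecture.Cruxes.H413.K2E1ResidualLevelFiniteOfAtomsU (residualSpectrumCompact_of_atoms)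

namespace Summit.HodgeConjecture.HodgeConjecture.Cruxes.H413.K2E1ResidualCompactOfAtomsSigs

/-- **SOCKET 5Res BY NAME: `sig_K2E1ResidualCompactU2` (Sigs ED. 12 :247, bytes verbatim) ⟸ the `∀ L μ ∃ K`-package of ATOMS for `L²_res(U(Φ₂)_{L∕L⁺})`** (★ p860247's package shape
with `hadm` replaced by `(ιa, ιf, hcont, hatoms)` of ★ `levelFinite_of_atoms`). [cite: MoeglinWaldspurger1995, I.2.18 and V.3.13] [cite: HarishChandra1968, Thm. 1] -/
theorem sig_K2E1ResidualCompactU2_of_atoms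
    (h : ∀ (L : Type) [Field L] [NumberField L] [IsCMField L]
      (μ : Measure (UnitaryGroup.cmDatum L 2 (Matrix.of fun i j : Fin 2 => if i.val + j.val + 1 = 2 then (1 : L) else 0)).automorphicQuotient)
      [(UnitaryGroup.cmDatum L 2 (Matrix.of fun i j : Fin 2 => if i.val + j.val + 1 = 2 then (1 : L) else 0)).IsAutomorphicMeasure μ],
      ∃ (K : Type) (_ : Group K) (_ : TopologicalSpace K) (_ : IsTopologicalGroup K) (_ : CompactSpace K) (_ : T2Space K)
        (ιK : K →* (UnitaryGroup.cmDatum L 2 (Matrix.of fun i j : Fin 2 => if i.val + j.val + 1 = 2 then (1 : L) else 0)).Adelic) (_ : Continuous ιK)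
        (T : Type) (_ : Group T) (ιa : T →* K) (_ : ∀ (t : T) (k : K), ιa t * k = k * ιa t)
        (Kf : Type) (_ : Group Kf) (_ : TopologicalSpace Kf) (_ : IsTopologicalGroup Kf) (_ : CompactSpace Kf) (_ : T2Space Kf) (_ : TotallyDisconnectedSpace Kf) (ιf : Kf →* K)
        (_ : ∀ v : (cmResidualSubspace L 2 μ).toSubmodule, Continuous fun k : Kf => ((cmResidualSubspace L 2 μ).toContRep.restrict ιK) (ιf k) v),
        ∀ (χ : T →* ℂ) (U : OpenSubgroup Kf), ∃ (P : (UnitaryGroup.cmDatum L 2 (Matrix.of fun i j : Fin 2 => if i.val + j.val + 1 = 2 then (1 : L) else 0)).L2 μ →L[ℂ] (UnitaryGroup.cmDatum L 2 (Matrix.of fun i j : Fin 2 => if i.val + j.val + 1 = 2 then (1 : L) else 0)).L2 μ) (At : Submodule ℂ ((UnitaryGroup.cmDatum L 2 (Matrix.of fun i j : Fin 2 => if i.val + j.val + 1 = 2 then (1 : L) else 0)).L2 μ)),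
          FiniteDimensional ℂ At ∧
          (∀ x : (UnitaryGroup.cmDatum L 2 (Matrix.of fun i j : Fin 2 => if i.val + j.val + 1 = 2 then (1 : L) else 0)).L2 μ, (∀ u ∈ U, (UnitaryGroup.cmDatum L 2 (Matrix.of fun i j : Fin 2 => if i.val + j.val + 1 = 2 then (1 : L) else 0)).rightRegular μ (ιK (ιf u)) x = x) →
            (∀ t : T, (UnitaryGroup.cmDatum L 2 (Matrix.of fun i j : Fin 2 => if i.val + j.val + 1 = 2 then (1 : L) else 0)).rightRegular μ (ιK (ιa t)) x = χ t • x) → P x = x) ∧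
          ∀ W : ContRepresentation.ClosedSubrep ((UnitaryGroup.cmDatum L 2 (Matrix.of fun i j : Fin 2 => if i.val + j.val + 1 = 2 then (1 : L) else 0)).rightRegular μ), W.toContRep.IsTopIrreducible → W ≤ cmResidualSubspace L 2 μ → ∀ w ∈ W, P w ∈ At) :
    ∀ (L : Type) [Field L] [NumberField L] [IsCMField L]
      (μ : Measure (UnitaryGroup.cmDatum L 2 (Matrix.of fun i j : Fin 2 => if i.val + j.val + 1 = 2 then (1 : L) else 0)).automorphicQuotient)
      [(UnitaryGroup.cmDatum L 2 (Matrix.of fun i j : Fin 2 => if i.val + j.val + 1 = 2 then (1 : L) else 0)).IsAutomorphicMeasure μ],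
      K2E1CuspidalSpectrumUnitary.CmResidualSpectrumCompact L 2 μ := by
  intro L _ _ _ μ _
  obtain ⟨K, _, _, _, _, _, ιK, hι, T, _, ιa, hιa, Kf, _, _, _, _, _, _, ιf, hcont, hatoms⟩ := h L μ
  exact residualSpectrumCompact_of_atoms _ μ (cmParabolicData L 2) ιK hι ιa hιa ιf hcont hatoms

/-- **SOCKET 12R3 BY NAME: `sig_K2E1ResidualCompactU3R` (Sigs ED. 12 :293, bytes verbatim) ⟸ the `∀ L μ ∃ K`-package of ATOMS for `L²_res(U(Φ₃)_{L∕L⁺})` along the Heisenberg radical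
of record** (★ `cmParabolicDataR L 3`). [cite: MoeglinWaldspurger1995, I.2.18 and V.3.13] [cite: Rogawski1990, §13.9 p. 227] -/
theorem sig_K2E1ResidualCompactU3R_of_atoms
    (h : ∀ (L : Type) [Field L] [NumberField L] [IsCMField L]
      (μ : Measure (UnitaryGroup.cmDatum L 3 (Matrix.of fun i j : Fin 3 => if i.val + j.val + 1 = 3 then (1 : L) else 0)).automorphicQuotient)
      [(UnitaryGroup.cmDatum L 3 (Matrix.of fun i j : Fin 3 => if i.val + j.val + 1 = 3 then (1 : L) else 0)).IsAutomorphicMeasure μ],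
      ∃ (K : Type) (_ : Group K) (_ : TopologicalSpace K) (_ : IsTopologicalGroup K) (_ : CompactSpace K) (_ : T2Space K)
        (ιK : K →* (UnitaryGroup.cmDatum L 3 (Matrix.of fun i j : Fin 3 => if i.val + j.val + 1 = 3 then (1 : L) else 0)).Adelic) (_ : Continuous ιK)
        (T : Type) (_ : Group T) (ιa : T →* K) (_ : ∀ (t : T) (k : K), ιa t * k = k * ιa t)
        (Kf : Type) (_ : Group Kf) (_ : TopologicalSpace Kf) (_ : IsTopologicalGroup Kf) (_ : CompactSpace Kf) (_ : T2Space Kf) (_ : TotallyDisconnectedSpace Kf) (ιf : Kf →* K)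
        (_ : ∀ v : (cmResidualSubspaceR L 3 μ).toSubmodule, Continuous fun k : Kf => ((cmResidualSubspaceR L 3 μ).toContRep.restrict ιK) (ιf k) v),
        ∀ (χ : T →* ℂ) (U : OpenSubgroup Kf), ∃ (P : (UnitaryGroup.cmDatum L 3 (Matrix.of fun i j : Fin 3 => if i.val + j.val + 1 = 3 then (1 : L) else 0)).L2 μ →L[ℂ] (UnitaryGroup.cmDatum L 3 (Matrix.of fun i j : Fin 3 => if i.val + j.val + 1 = 3 then (1 : L) else 0)).L2 μ) (At : Submodule ℂ ((UnitaryGroup.cmDatum L 3 (Matrix.of fun i j : Fin 3 => if i.val + j.val + 1 = 3 then (1 : L) else 0)).L2 μ)),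
          FiniteDimensional ℂ At ∧
          (∀ x : (UnitaryGroup.cmDatum L 3 (Matrix.of fun i j : Fin 3 => if i.val + j.val + 1 = 3 then (1 : L) else 0)).L2 μ, (∀ u ∈ U, (UnitaryGroup.cmDatum L 3 (Matrix.of fun i j : Fin 3 => if i.val + j.val + 1 = 3 then (1 : L) else 0)).rightRegular μ (ιK (ιf u)) x = x) →
            (∀ t : T, (UnitaryGroup.cmDatum L 3 (Matrix.of fun i j : Fin 3 => if i.val + j.val + 1 = 3 then (1 : L) else 0)).rightRegular μ (ιK (ιa t)) x = χ t • x) → P x = x) ∧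
          ∀ W : ContRepresentation.ClosedSubrep ((UnitaryGroup.cmDatum L 3 (Matrix.of fun i j : Fin 3 => if i.val + j.val + 1 = 3 then (1 : L) else 0)).rightRegular μ), W.toContRep.IsTopIrreducible → W ≤ cmResidualSubspaceR L 3 μ → ∀ w ∈ W, P w ∈ At) :
    ∀ (L : Type) [Field L] [NumberField L] [IsCMField L]
      (μ : Measure (UnitaryGroup.cmDatum L 3 (Matrix.of fun i j : Fin 3 => if i.val + j.val + 1 = 3 then (1 : L) else 0)).automorphicQuotient)
      [(UnitaryGroup.cmDatum L 3 (Matrix.of fun i j : Fin 3 => if i.val + j.val + 1 = 3 then (1 : L) else 0)).IsAutomorphicMeasure μ],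
      K2E1CuspidalSpectrumUnitary.CmResidualSpectrumCompactR L 3 μ := by
  intro L _ _ _ μ _
  obtain ⟨K, _, _, _, _, _, ιK, hι, T, _, ιa, hιa, Kf, _, _, _, _, _, _, ιf, hcont, hatoms⟩ := h L μ
  exact residualSpectrumCompact_of_atoms _ μ (cmParabolicDataR L 3) ιK hι ιa hιa ιf hcont hatoms

end Summit.HodgeConjecture.HodgeConjecture.Cruxes.H413.K2E1ResidualCompactOfAtomsSigs

end
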